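import Literature.Geometry.Lorentzian.AsymptoticFlatness
import Literature.Geometry.Lorentzian.CurvatureNaturality
import Literature.Geometry.Lorentzian.ChartScalarCurvature
import Literature.Geometry.Lorentzian.IsometryProofs
import Literature.Geometry.Lorentzian.LeviCivitaProofs
import Mathlib.Analysis.SpecialFunctions.JapaneseBracket
import Mathlib.Analysis.InnerProductSpace.Calculus
import Mathlib.Analysis.SpecialFunctions.SmoothTransition
import HarnessLib

/-!
# The metric of an asymptotically flat end in its chart

Support file (all results proved) for Bartnik's existence theorem for the ADM energy
(`AFEnd.HasADMEnergy_of_isAsymptoticallyFlat`). For an end `e : AFEnd X` with inverse chart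
`Φ = e.dataChart : {R < ‖x‖} → X` and initial data `D`:

* `injective_mfderiv_dataChart` — `Φ` is an immersion (it has the smooth left inverse
  `e.chart`), so the **pullback metric** `Φ^* h` on the open set `{R < ‖x‖} ⊆ ℝ³` is defined
  (`PseudoRiemannianMetric.comap`), and its representative is `hCoeff e D` (`val_comap_dataChart`);
* `contDiffAt_hCoeff` — the chart components `h_ij` are smooth at every point of `{R < ‖x‖}`
  (another route to `ContDiffOn_hCoeff_holds` of `AsymptoticFlatnessProofs`);
* `exists_smooth_radial_cutoff`, `integrableOn_rpow_neg_exterior`, `exists_radius_of_eventually` — analytic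
  preliminaries on `ℝ³` (smooth radial cut-off, integrability of `‖x‖^{-s}`, `s > 3`, at infinity);
* `scalarCurvatureCoeff_eq_coord` — the scalar curvature read in the chart,
  `scalarCurvatureCoeff e D x = R(h)(Φ x)`, equals the scalar curvature of `Φ^* h` at `x`
  (naturality, `scalarCurvature_comap`) and hence the explicit coordinate expression
  `OpensChart.scalarCurvature_eq_coord` in the components `hCoeff e D` and any orthonormal frame.

## References

* R. Bartnik, *The mass of an asymptotically flat manifold*, CPAM 39 (1986), §1 and §4.
* B. O'Neill, *Semi-Riemannian geometry* (1983), Ch. 3, pp. 58, 90–91, Prop. 3.59.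
-/

noncomputable section

-- instance search on the nested operator spaces of metric components and their derivatives
set_option maxSynthPendingDepth 3

open Manifold Bundle TopologicalSpace Filter Metric MeasureTheory Bornology
open scoped ContDiff Topology

namespace Literature.Geometry.Lorentzian

namespace AFEnd

variable {X : Type*} [TopologicalSpace X] [ChartedSpace E3 X] [IsManifold (𝓡 3) ∞ X]
  (e : AFEnd X) (D : InitialDataSet (𝓡 3) X)

/-! ### The inverse chart is an immersion -/

omit [IsManifold (𝓡 3) ∞ X] in
/-- The chart `e.chart`, extended by a junk value off the end `U`, as a map `X → E3`. [folklore] -/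
theorem exists_leftInverse_dataChart :
    ∃ ψ : X → E3, (∀ u, ψ (e.dataChart u) = u) ∧
      ∀ u, ContMDiffAt (𝓡 3) (𝓡 3) ∞ ψ (e.dataChart u) := by
  classical
  refine ⟨fun p ↦ if hp : p ∈ e.U then ((e.chart ⟨p, hp⟩ : exteriorRegion e.R) : E3) else 0,
    fun u ↦ ?_, fun u ↦ ?_⟩
  · have hp : e.dataChart u ∈ e.U := (e.chart.symm u).2
    beta_reduce
    rw [dif_pos hp]
    have : (⟨e.dataChart u, hp⟩ : e.U) = e.chart.symm u := rfl
    rw [this, e.chart.apply_symm_apply]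
  · have hp : e.dataChart u ∈ e.U := (e.chart.symm u).2
    have key : ContMDiffAt (𝓡 3) (𝓡 3) ∞
        (fun q : e.U ↦ (fun p ↦ if hp : p ∈ e.U then
          ((e.chart ⟨p, hp⟩ : exteriorRegion e.R) : E3) else 0) (q : X)) ⟨e.dataChart u, hp⟩ := by
      have hfun : (fun q : e.U ↦ (fun p ↦ if hp : p ∈ e.U then
          ((e.chart ⟨p, hp⟩ : exteriorRegion e.R) : E3) else 0) (q : X)) =
          fun q : e.U ↦ ((e.chart q : exteriorRegion e.R) : E3) := by
        funext q
        simp only [dif_pos q.2]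
      rw [hfun]
      exact (contMDiff_subtype_val.comp e.chart.contMDiff) _
    exact contMDiffAt_subtype_iff.1 key

omit [IsManifold (𝓡 3) ∞ X] in
/-- **The inverse chart of the end is an immersion**: `dΦ_u` is injective for every `u`
(indeed `e.chart ∘ Φ = id` near `u`). Bartnik 1986, §1. [cite: Bartnik1986, §1] -/
theorem injective_mfderiv_dataChart (u : exteriorRegion e.R) :
    Function.Injective (mfderiv (𝓡 3) (𝓡 3) e.dataChart u) := by
  obtain ⟨ψ, hψ, hψs⟩ := e.exists_leftInverse_dataChart
  have hΦ : MDifferentiableAt (𝓡 3) (𝓡 3) e.dataChart u :=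
    (e.contMDiff_dataChart u).mdifferentiableAt (by simp)
  have hψd : MDifferentiableAt (𝓡 3) (𝓡 3) ψ (e.dataChart u) :=
    (hψs u).mdifferentiableAt (by simp)
  have hcomp : mfderiv (𝓡 3) (𝓡 3) (ψ ∘ e.dataChart) u =
      (mfderiv (𝓡 3) (𝓡 3) ψ (e.dataChart u)).comp (mfderiv (𝓡 3) (𝓡 3) e.dataChart u) :=
    mfderiv_comp u hψd hΦ
  have hid : ψ ∘ e.dataChart = (Subtype.val : exteriorRegion e.R → E3) := funext hψ
  have hval : mfderiv (𝓡 3) (𝓡 3) (Subtype.val : exteriorRegion e.R → E3) u =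
      ContinuousLinearMap.id ℝ E3 := by
    have := OpensChart.mfderiv_eq (U := exteriorRegion e.R) (F := E3) u Subtype.val id
      (fun _ ↦ rfl) differentiableAt_id
    rw [fderiv_id] at this
    exact this
  have hinj : Function.Injective
      ((mfderiv (𝓡 3) (𝓡 3) ψ (e.dataChart u)).comp (mfderiv (𝓡 3) (𝓡 3) e.dataChart u)) := by
    rw [← hcomp, hid, hval]
    exact fun v w h ↦ h
  have hinj' : Function.Injective
      (⇑(mfderiv (𝓡 3) (𝓡 3) ψ (e.dataChart u)) ∘ ⇑(mfderiv (𝓡 3) (𝓡 3) e.dataChart u)) := hinj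
  exact hinj'.of_comp

omit [IsManifold (𝓡 3) ∞ X] in
/-- The inverse chart is `C^{∞+1} = C^∞`. [folklore] -/
theorem contMDiff_dataChart_succ : ContMDiff (𝓡 3) (𝓡 3) (∞ + 1) e.dataChart := by
  have h : ((∞ : ℕ∞ω) + 1) = ∞ := rfl
  rw [h]
  exact e.contMDiff_dataChart

/-! ### The pullback metric on the exterior region and its representative -/

/-- **The representative of the pullback metric is `hCoeff`**: for the pullback `Φ^* h` of the
metric along the inverse chart (a pseudo-Riemannian metric on the open set `{R < ‖x‖}`),
`(Φ^* h)_y = hCoeff e D y`. Bartnik 1986, (1.3). [cite: Bartnik1986, (1.3)] -/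
theorem val_comap_dataChart (y : exteriorRegion e.R) :
    (D.metric.comap PseudoRiemannianMetric.contMDiff_pullbackBilin_holds e.dataChart
      e.contMDiff_dataChart_succ e.injective_mfderiv_dataChart rfl).val y = hCoeff e D y := by
  rw [PseudoRiemannianMetric.val_comap, hCoeff_of_lt D y.2]
  rfl

/-- The chart components are smooth at every point of the exterior region. Bartnik 1986, §1.
[cite: Bartnik1986, §1] -/
theorem contDiffAt_hCoeff {x : E3} (hx : e.R < ‖x‖) : ContDiffAt ℝ ∞ (hCoeff e D) x :=
  OpensChart.contDiffAt_repr (e.val_comap_dataChart D) ⟨x, hx⟩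

/-- Eventually (along `Bornology.cobounded`) the chart components are smooth. [folklore] -/
theorem eventually_contDiffAt_hCoeff :
    ∀ᶠ x in Bornology.cobounded E3, ContDiffAt ℝ ∞ (hCoeff e D) x := by
  have h : ∀ᶠ x in Bornology.cobounded E3, e.R < ‖x‖ := by
    have := eventually_cobounded_le_norm (E := E3) (e.R + 1)
    exact this.mono fun x hx ↦ by linarith
  exact h.mono fun x hx ↦ e.contDiffAt_hCoeff D hx

/-! ### The scalar curvature in the chart -/

/-- **The scalar curvature read in the chart is the scalar curvature of the pullback metric**:
`scalarCurvatureCoeff e D x = S^{Φ^*h}(x)` for `R < ‖x‖` (naturality of curvature under the local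
isometry `Φ`; O'Neill 1983, Prop. 3.59). [cite: ONeill1983, Ch. 3, Prop. 3.59] -/
theorem scalarCurvatureCoeff_eq_comap [D.metric.HasLeviCivita] {x : E3} (hx : e.R < ‖x‖) :
    scalarCurvatureCoeff e D x =
      (haveI := (D.metric.comap PseudoRiemannianMetric.contMDiff_pullbackBilin_holds e.dataChart
        e.contMDiff_dataChart_succ e.injective_mfderiv_dataChart rfl).hasLeviCivita
      (D.metric.comap PseudoRiemannianMetric.contMDiff_pullbackBilin_holds e.dataChart
        e.contMDiff_dataChart_succ e.injective_mfderiv_dataChart rfl).scalarCurvature ⟨x, hx⟩) := by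
  haveI := (D.metric.comap PseudoRiemannianMetric.contMDiff_pullbackBilin_holds e.dataChart
    e.contMDiff_dataChart_succ e.injective_mfderiv_dataChart rfl).hasLeviCivita
  rw [scalarCurvatureCoeff, dif_pos hx, PseudoRiemannianMetric.scalarCurvature_comap]

/-- **The scalar curvature of the end in coordinates.** For `R < ‖x‖` and any orthonormal frame
`b` of `ℝ³`, `scalarCurvatureCoeff e D x = R(h)(Φ x)` is the explicit rational expression
`∑ g^{lk} g^{ji} [½(∂ᵢK(b_l,b_k,b_j) − ∂_k K(b_l,b_i,b_j)) − g^{ca} ¼KK + g^{ca} ¼KK]` in the inverse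
Gram matrix `g^{ab} = ((hCoeff e D x (b_i, b_j))ᵢⱼ)⁻¹`, the Koszul form `K = koszulForm (hCoeff e D)`
(first derivatives of `h_ij`) and its first derivatives (O'Neill 1983, Lemma 3.38, Def. 3.53 and
Prop. 3.59; Bartnik 1986, §4). [cite: ONeill1983, Ch. 3, Lemma 3.38, Def. 3.53, Prop. 3.59] -/
theorem scalarCurvatureCoeff_eq_coord [D.metric.HasLeviCivita] {ι : Type*} [Fintype ι]
    [DecidableEq ι] (b : OrthonormalBasis ι ℝ E3) {x : E3} (hx : e.R < ‖x‖) :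
    scalarCurvatureCoeff e D x =
      ∑ k, ∑ l, (Matrix.of fun i j ↦ hCoeff e D x (b i) (b j))⁻¹ l k *
        ∑ i, ∑ j, (Matrix.of fun i j ↦ hCoeff e D x (b i) (b j))⁻¹ j i *
          (2⁻¹ * (fderiv ℝ (fun y ↦ OpensChart.koszulForm (hCoeff e D) y (b l) (b k) (b j)) x (b i)
              - fderiv ℝ (fun y ↦ OpensChart.koszulForm (hCoeff e D) y (b l) (b i) (b j)) x (b k))
            - ∑ a, ∑ c, (Matrix.of fun i j ↦ hCoeff e D x (b i) (b j))⁻¹ c a *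
                (2⁻¹ * OpensChart.koszulForm (hCoeff e D) x (b j) (b i) (b c)) *
                (2⁻¹ * OpensChart.koszulForm (hCoeff e D) x (b l) (b k) (b a))
            + ∑ a, ∑ c, (Matrix.of fun i j ↦ hCoeff e D x (b i) (b j))⁻¹ c a *
                (2⁻¹ * OpensChart.koszulForm (hCoeff e D) x (b j) (b k) (b c)) *
                (2⁻¹ * OpensChart.koszulForm (hCoeff e D) x (b l) (b i) (b a))) := by
  haveI := (D.metric.comap PseudoRiemannianMetric.contMDiff_pullbackBilin_holds e.dataChart
    e.contMDiff_dataChart_succ e.injective_mfderiv_dataChart rfl).hasLeviCivita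
  rw [e.scalarCurvatureCoeff_eq_comap D hx,
    OpensChart.scalarCurvature_eq_coord (e.val_comap_dataChart D) ⟨x, hx⟩ b.toBasis]
  rfl

/-! ### Analytic preliminaries on `ℝ³` -/

/-- Extraction of a radius from an eventual statement along `Bornology.cobounded`. [folklore] -/
theorem exists_radius_of_eventually {P : E3 → Prop} (h : ∀ᶠ x in cobounded E3, P x) :
    ∃ R₁ : ℝ, ∀ x : E3, R₁ ≤ ‖x‖ → P x := by
  rw [← comap_norm_atTop, eventually_comap, eventually_atTop] at h
  obtain ⟨R₁, hR⟩ := h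
  exact ⟨R₁, fun x hx ↦ hR ‖x‖ hx x rfl⟩

/-- `‖x‖^{-s}` is integrable on `{R₁ < ‖x‖}` for `s > 3 = dim ℝ³` and `R₁ ≥ 1` (comparison with
the integrable Japanese bracket `(1 + ‖x‖)^{-s}`, Mathlib `integrable_one_add_norm`). [folklore] -/
theorem integrableOn_rpow_neg_exterior {s R₁ : ℝ} (hs : 3 < s) (hR₁ : 1 ≤ R₁) :
    IntegrableOn (fun x : E3 ↦ ‖x‖ ^ (-s)) {x | R₁ < ‖x‖} volume := by
  have hint : Integrable (fun x : E3 ↦ (2 : ℝ) ^ s * (1 + ‖x‖) ^ (-s)) volume := by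
    refine (integrable_one_add_norm ?_).const_mul _
    simpa using hs
  refine Integrable.mono' hint.integrableOn ?_ ?_
  · exact (continuous_norm.measurable.pow_const _).aestronglyMeasurable
  · refine (ae_restrict_iff' (isOpen_lt continuous_const continuous_norm).measurableSet).2
      (ae_of_all _ fun x hx ↦ ?_)
    have hx1 : 1 ≤ ‖x‖ := hR₁.trans (le_of_lt hx)
    have hxpos : 0 < ‖x‖ := by linarith
    rw [Real.norm_of_nonneg (Real.rpow_nonneg hxpos.le _)]
    have h2 : 1 + ‖x‖ ≤ 2 * ‖x‖ := by linarith
    have hs0 : 0 ≤ s := by linarith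
    calc ‖x‖ ^ (-s) = (2 : ℝ) ^ s * (2 * ‖x‖) ^ (-s) := by
          rw [Real.mul_rpow (by norm_num) hxpos.le, Real.rpow_neg (by norm_num : (0 : ℝ) ≤ 2),
            ← mul_assoc, mul_inv_cancel₀ (by positivity), one_mul]
      _ ≤ (2 : ℝ) ^ s * (1 + ‖x‖) ^ (-s) := by
          refine mul_le_mul_of_nonneg_left ?_ (by positivity)
          exact Real.rpow_le_rpow_of_nonpos (by positivity) h2 (by linarith)

/-- A smooth radial cut-off: `χ = 0` on `‖x‖ ≤ R + 1`, `χ = 1` on `R + 2 ≤ ‖x‖` (`R ≥ 0`;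
Mathlib's `Real.smoothTransition` of an affine function of `‖x‖²`). [folklore] -/
theorem exists_smooth_radial_cutoff {R : ℝ} (hR : 0 ≤ R) :
    ∃ χ : E3 → ℝ, ContDiff ℝ ∞ χ ∧ (∀ x, ‖x‖ ≤ R + 1 → χ x = 0) ∧
      ∀ x, R + 2 ≤ ‖x‖ → χ x = 1 := by
  have hden : 0 < (R + 2) ^ 2 - (R + 1) ^ 2 := by nlinarith
  refine ⟨fun x ↦ Real.smoothTransition ((‖x‖ ^ 2 - (R + 1) ^ 2) / ((R + 2) ^ 2 - (R + 1) ^ 2)),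
    ?_, fun x hx ↦ ?_, fun x hx ↦ ?_⟩
  · exact Real.smoothTransition.contDiff.comp
      (((contDiff_norm_sq ℝ).sub contDiff_const).div_const _)
  · refine Real.smoothTransition.zero_of_nonpos (div_nonpos_of_nonpos_of_nonneg ?_ hden.le)
    have h1 : ‖x‖ ^ 2 ≤ (R + 1) ^ 2 := pow_le_pow_left₀ (norm_nonneg x) hx 2
    linarith
  · refine Real.smoothTransition.one_of_one_le ((one_le_div hden).2 ?_)
    have h1 : (R + 2) ^ 2 ≤ ‖x‖ ^ 2 := pow_le_pow_left₀ (by linarith) hx 2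
    linarith

end AFEnd

end Literature.Geometry.Lorentzian

end
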